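import Summits.HubbardSuperconductivity.HubbardSuperconductivity.Theorems.AnisotropyChordTransferFibre3B1EvalTx

/-!
# Route `AnisotropyChord` / H0 rotor rung, LEVEL 2 family B1: the `L₀`-GENERIC cell evaluator for the cos-weighted
convolutions `Tx(1,0)`, `Tx(1,1)` (t-blocks `L₀ ≤ L`)

`…Fibre3B1EvalTx` certifies `clo ≤ θ⁴·Tx(q) ≤ chi` for every `L ≥ 128` with the window scale `θ₀ = 2π/128`, `K = 32`,
`K′ = 30` HARD-CODED, although the pointwise bracket `txBracket_of L θ₀ K` (`…N1RowBrackets`) and the plain-sum evaluator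
`B1.cellCheck L₀`/`B1.cell_sound` (`…B1Eval`/`…B1EvalSound`, `K = L₀/4`) are generic in the block floor `L₀`.  For the
t-BLOCK certificates of the range `48 ≤ L < 128` (route-lead ruling R1: blocks `[48,64)`, `[64,96)`, `[96,128)`) this file
supplies the missing generic piece, verbatim the argument of `B1.tx_cell_sound` with `128 ↦ L₀`, `32 ↦ L₀/4`, `30 ↦ L₀/4 − 2`:
* `txCellCheckG L₀ n₁ n₂ νd Tn Td q D clo chi : Bool` (requires `16 ≤ L₀`, i.e. `K = L₀/4 ≥ 4`);
* ★ `tx_cell_soundG`: `txCellCheckG L₀ … = true` ⟹ for every `L ≥ L₀` and `ν ∈ [n₁/νd, n₂/νd]`,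
  `clo ≤ (2π/L)⁴ · TxSum L (ν(2π/L)²) q ≤ chi`.
Bracket widths of `θ⁴Tx` at `ν ≈ .02`: `.072 / .12 / .27 / .50` for `L₀ = 128 / 96 / 64 / 48` (session probe, exact mirror
`b1certG.py`).
Prover seat `hubbard-h0-rotor-p2` g8; helper for piece A = stmt-HubbardSuperconductivity-23918 of rung 19089
(`--supports`, helper class).  Nothing here proves superconductivity in the Hubbard model; helper definitions/lemmas of ONE
conditional reduction (the GM₃ ∀L certificate, Level-2 row `N₁`, t-blocks); the rotor TARGET as originally worded stays FALSE
(g15 verdict).  Mathlib + the tree only; no sorry.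
-/

set_option linter.dupNamespace false
set_option autoImplicit false

open scoped BigOperators

namespace Summit.HubbardSuperconductivity.HubbardSuperconductivity.Theorems.AnisotropyChord.Transfer.Fibre3.B1

/-! ## Computable layer -/

/-- ★ THE `L₀`-GENERIC CELL CERTIFICATE for `θ⁴·Tx(q)` on the `ν`-cell `[n₁/νd, n₂/νd]` (`θ₀ = 2π/L₀`, `K = L₀/4 ≥ 4`,
`K′ = K − 2`, `q ∈ {(1,0),(1,1)}`, `T = Tn/Td ≥ θ₀²`). -/
def txCellCheckG (L0 : ℕ) (n1 n2 νd Tn Td : ℤ) (q : ℤ × ℤ) (D : ℕ) (clo chi : ℚ) : Bool :=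
  decide (0 < νd) && decide (0 < Td) && decide (0 ≤ n1) && decide (n1 ≤ n2) &&
  decide ((n2 : ℚ) / νd * piHi ^ 2 < 4) &&
  decide ((2 * piHi / L0) ^ 2 * Td ≤ Tn) && decide (0 < D) && decide (16 ≤ L0) &&
  (decide (q = (1, 0)) || decide (q = (1, 1))) &&
  hiDenPos n2 νd Tn Td (L0 / 4) &&
  decide ((clo + tailConstQ n2 νd (L0 / 4 - 2 * 1) 2) * D ≤ (loSumTxZ n1 νd Tn Td (L0 / 4) q D : ℚ)) &&
  decide (((hiSumZ n2 νd Tn Td (L0 / 4) 1 ![((0 : ℤ × ℤ)), -q] ![1, 1] 2 D : ℤ) : ℚ)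
    ≤ (chi - tailConstQ n2 νd (L0 / 4 - 2 * 1) 2) * D)

/-! ## Soundness -/

noncomputable section

/-- ★★ **SOUNDNESS OF THE `L₀`-GENERIC `Tx` CELL CERTIFICATE**: `txCellCheckG L₀ n₁ n₂ νd Tn Td q D clo chi = true` ⟹ for
every `L ≥ L₀` and every `ν ∈ [n₁/νd, n₂/νd]`: `clo ≤ (2π/L)⁴ · TxSum L (ν(2π/L)²) q ≤ chi`. -/
theorem tx_cell_soundG (L0 : ℕ) (n1 n2 νd Tn Td : ℤ) (q : ℤ × ℤ) (D : ℕ) (clo chi : ℚ)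
    (h : txCellCheckG L0 n1 n2 νd Tn Td q D clo chi = true)
    (L : ℕ) [NeZero L] (hL : L0 ≤ L) (ν : ℝ) (hν1 : (n1 : ℝ) / νd ≤ ν) (hν2 : ν ≤ (n2 : ℝ) / νd) :
    ((clo : ℚ) : ℝ) ≤ (2 * Real.pi / L) ^ (2 * 2) * TxSum L (ν * (2 * Real.pi / L) ^ 2) q ∧
      (2 * Real.pi / L) ^ (2 * 2) * TxSum L (ν * (2 * Real.pi / L) ^ 2) q ≤ ((chi : ℚ) : ℝ) := by
  unfold txCellCheckG at h
  simp only [Bool.and_eq_true, Bool.or_eq_true, decide_eq_true_eq] at h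
  obtain ⟨⟨⟨⟨⟨⟨⟨⟨⟨⟨⟨hνd, hTd⟩, hn1⟩, hn12⟩, hc⟩, hT⟩, hD⟩, hL0⟩, hq⟩, hpos⟩, hlo⟩, hhi⟩ := h
  have hpi := Real.pi_pos
  have hP : Real.pi ≤ ((piHi : ℚ) : ℝ) := by
    have e : ((piHi : ℚ) : ℝ) = 3.1416 := by unfold piHi; norm_num
    rw [e]
    exact Real.pi_lt_d4.le
  have hq1 : q.1 = 1 ∧ q.2.natAbs ≤ 1 := by rcases hq with rfl | rfl <;> decide
  have hK4 : 4 ≤ L0 / 4 := by omega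
  -- the cell endpoints
  have hνdR : (0 : ℝ) < νd := by exact_mod_cast hνd
  have hν1_0 : (0 : ℝ) ≤ (n1 : ℝ) / νd := div_nonneg (by exact_mod_cast hn1) hνdR.le
  have hn2R : (0 : ℝ) ≤ (n2 : ℝ) / νd := div_nonneg (by exact_mod_cast (hn1.trans hn12)) hνdR.le
  have hcR : (n2 : ℝ) / νd * (((piHi : ℚ) : ℝ)) ^ 2 < 4 := by exact_mod_cast hc
  have hν2_lt : (n2 : ℝ) / νd < 4 / Real.pi ^ 2 := by
    rw [lt_div_iff₀ (by positivity)]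
    have : Real.pi ^ 2 ≤ (((piHi : ℚ) : ℝ)) ^ 2 := pow_le_pow_left₀ hpi.le hP 2
    nlinarith
  have hν0 : 0 ≤ ν := hν1_0.trans hν1
  have hν : ν < 4 / Real.pi ^ 2 := lt_of_le_of_lt hν2 hν2_lt
  have hν_1 : ν < 1 := by
    have hpi3 := Real.pi_gt_three
    refine lt_of_lt_of_le hν ?_
    rw [div_le_one (by positivity)]; nlinarith
  -- scales
  have hL0pos : 0 < L0 := by omega
  obtain ⟨hθ0, hθ0K⟩ := scales_of_L0 L L0 hL0pos hL
  have hL0R : (0 : ℝ) < L0 := by exact_mod_cast hL0pos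
  have hθ0pos : (0 : ℝ) < 2 * Real.pi / L0 := by positivity
  have hθ0K' : 2 * Real.pi / L0 * ((((L0 / 4 : ℕ)) : ℝ) - 1 / 2) ≤ Real.pi / 2 := by nlinarith
  -- the pointwise bracket at `ν`
  obtain ⟨hmid_lo, hmid_hi⟩ := txBracket_of L (2 * Real.pi / L0) (L0 / 4) hK4 hθ0 hθ0K ν hν0 hν q hq1
  -- T dominates θ₀²
  have hTd' : (0 : ℝ) < Td := by exact_mod_cast hTd
  have hTR : (2 * Real.pi / L0) ^ 2 * (Td : ℝ) ≤ Tn := by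
    have h1 : (2 * Real.pi / L0) ^ 2 ≤ (2 * (((piHi : ℚ) : ℝ)) / L0) ^ 2 := by
      apply pow_le_pow_left₀ (by positivity)
      exact div_le_div_of_nonneg_right (by linarith) hL0R.le
    have h2' : (2 * (((piHi : ℚ) : ℝ)) / L0) ^ 2 * (Td : ℝ) ≤ Tn := by exact_mod_cast hT
    nlinarith
  have hDR : (0 : ℝ) < D := by exact_mod_cast hD
  -- evaluations
  have elo := loSumTxZ_le n1 νd Tn Td hνd hTd (2 * Real.pi / L0) hθ0pos hTR (L0 / 4) hθ0K' q hq1.1 D ν hν1 hν_1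
  have ehi := hiSum_le_hiSumZ n2 νd Tn Td hνd hTd (2 * Real.pi / L0) hTR (L0 / 4) 1 hpos
    ![((0 : ℤ × ℤ)), -q] ![1, 1] 2 D (by simp)
  have etail := tailConst_le_tailConstQ n2 νd hνd (hn1.trans hn12) hc (L0 / 4 - 2 * 1) 2 (by omega)
  have etail_mono : tailConst ν (L0 / 4 - 2 * 1) 2 ≤ tailConst ((n2 : ℝ) / νd) (L0 / 4 - 2 * 1) 2 :=
    tailConst_mono ν _ hν0 hν2 hν2_lt (L0 / 4 - 2 * 1) 2 (by omega)
  have ehi_mono := hiSum_mono L ν ((n2 : ℝ) / νd) hν2 hν2_lt (2 * Real.pi / L0) (L0 / 4) 1 hθ0 hθ0K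
    ![((0 : ℤ × ℤ)), -q] ![1, 1]
  have hloR : (((clo : ℚ) : ℝ) + ((tailConstQ n2 νd (L0 / 4 - 2 * 1) 2 : ℚ) : ℝ)) * D
      ≤ ((loSumTxZ n1 νd Tn Td (L0 / 4) q D : ℤ) : ℝ) := by exact_mod_cast hlo
  have hhiR : ((hiSumZ n2 νd Tn Td (L0 / 4) 1 ![((0 : ℤ × ℤ)), -q] ![1, 1] 2 D : ℤ) : ℝ)
      ≤ (((chi : ℚ) : ℝ) - ((tailConstQ n2 νd (L0 / 4 - 2 * 1) 2 : ℚ) : ℝ)) * D := by exact_mod_cast hhi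
  constructor
  · have h1 : ((clo : ℚ) : ℝ) + ((tailConstQ n2 νd (L0 / 4 - 2 * 1) 2 : ℚ) : ℝ)
        ≤ loSumTx ν (2 * Real.pi / L0) (L0 / 4) q := by
      rw [← mul_le_mul_iff_left₀ hDR]
      calc (((clo : ℚ) : ℝ) + ((tailConstQ n2 νd (L0 / 4 - 2 * 1) 2 : ℚ) : ℝ)) * D ≤ _ := hloR
        _ ≤ (D : ℝ) * loSumTx ν (2 * Real.pi / L0) (L0 / 4) q := elo
        _ = loSumTx ν (2 * Real.pi / L0) (L0 / 4) q * D := mul_comm _ _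
    linarith
  · have h1 : hiSum ((n2 : ℝ) / νd) (2 * Real.pi / L0) (L0 / 4) 1 ![((0 : ℤ × ℤ)), -q] ![1, 1]
        ≤ ((chi : ℚ) : ℝ) - ((tailConstQ n2 νd (L0 / 4 - 2 * 1) 2 : ℚ) : ℝ) := by
      rw [← mul_le_mul_iff_left₀ hDR]
      calc hiSum ((n2 : ℝ) / νd) (2 * Real.pi / L0) (L0 / 4) 1 ![((0 : ℤ × ℤ)), -q] ![1, 1] * D
          = (D : ℝ) * hiSum ((n2 : ℝ) / νd) (2 * Real.pi / L0) (L0 / 4) 1 ![((0 : ℤ × ℤ)), -q] ![1, 1] :=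
            mul_comm _ _
        _ ≤ _ := ehi
        _ ≤ _ := hhiR
    linarith

end

end Summit.HubbardSuperconductivity.HubbardSuperconductivity.Theorems.AnisotropyChord.Transfer.Fibre3.B1
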